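import Literature.Dynamics.NBody.JensenLeykin2025S3Dictionary
import Literature.Dynamics.NBody.JensenLeykin2025Roberts
import Mathlib.Tactic
import HarnessLib

/-!
# The enriched system S3 is still positive-dimensional on the Roberts line of `E32`

`JensenLeykin2025Roberts.lean` shows the Jensen–Leykin torus system (equation set S1) contains the
explicit real curve `κ ρ(t)` at the masses `(1/2,1/2,1/2,1/2,1/8)` ~ `(4,4,4,4,1) ∈ E32`.  The cell's
certificates also use the ENRICHED sets S2 ⊂ S3 (bordered Cayley–Menger rank ≤ 4, Hampton–Jensen
`e_IU = 0`; tree file `JensenLeykin2025S3Dictionary.lean`).  Here: the same curve satisfies the extra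
equations too — `ρ(t)²` is planar data and `U = I` holds identically along the family (indeed
`Σ m_i m_j/ρ_ij = 1`, `Σ m_i m_j ρ_ij² = 17/8`) — so

* `s3NormalizedCCs_robertsMasses_infinite`, `s3NormalizedCCs_44441_infinite`;
* `e32S3Target_poly_vanishes_on_robertsLine` / `_at_441`: every exceptional polynomial `P(a,b,c)`
  of an S3 certificate generic on `E32` vanishes at `(4s,4s,s)`, `s ≠ 0`.

Hence neither S1 nor S3 certificates can be pointed on the Roberts line; finiteness of positive
central configurations for masses `(4s,4s,4s,4s,s)` is untouched by the torus method.
-/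

namespace Literature.Dynamics.NBody

open Finset

/-- `e_IU` is homogeneous of degree 2 in the masses. [folklore] -/
theorem eIU_smul_masses {K : Type*} [Field K] {n : ℕ} (s : K) (m : Fin n → K)
    (r : Fin n → Fin n → K) : eIU (fun k => s * m k) r = s ^ 2 * eIU m r := by
  unfold eIU
  rw [Finset.mul_sum]
  refine Finset.sum_congr rfl fun i _ => ?_
  rw [Finset.mul_sum]
  refine Finset.sum_congr rfl fun j _ => ?_
  split_ifs <;> ring

/-- The S3 solution set is invariant under scaling the masses. [folklore] -/
theorem s3NormalizedCCs_smul_masses {K : Type*} [Field K] (s : K) (hs : s ≠ 0) (m : Fin 5 → K) :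
    s3NormalizedCCs K (fun k => s * m k) = s3NormalizedCCs K m := by
  ext r
  have hs2 : s ^ 2 ≠ 0 := pow_ne_zero 2 hs
  simp only [s3NormalizedCCs, Set.mem_setOf_eq, jlNormalizedCCs_smul_masses s hs,
    eIU_smul_masses, mul_eq_zero, hs2, false_or]

/-- The signed Roberts curve IS the dictionary image of the modified Roberts continuum of (4):
`κ ρ(t) = κ / δ(a(t), b(t))`. [cite: AlbouyKaloshin2012, p. 543 — derived in-tree] -/
theorem jlRobertsR_eq_jlOfDelta (κ t : ℝ) (hA : jlRobA t ≠ 0) (hB : jlRobB t ≠ 0) :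
    jlRobertsR κ t = jlOfDelta κ (robertsDelta (jlRobA t) (jlRobB t)) := by
  funext i j
  fin_cases i <;> fin_cases j <;> simp [jlRobertsR, signedRho, jlOfDelta, robertsDelta] <;>
    field_simp

/-- `U = I` ON THE SIGNED ROBERTS FAMILY (`κ³ = 8/17`, `t > 1`).
[cite: HamptonJensen2011, eq. (7) p. 4 — derived in-tree] -/
theorem eIU_jlRobertsR (κ t : ℝ) (hκ : κ ^ 3 = 8 / 17) (ht : 1 < t) :
    eIU robertsMasses (jlRobertsR κ t) = 0 := by
  have hκ0 : κ ≠ 0 := by rintro rfl; norm_num at hκ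
  have ht' : 1 - t ^ 2 ≠ 0 := by nlinarith
  have h1 : (1 : ℝ) + t ^ 2 ≠ 0 := by positivity
  have hA : jlRobA t ≠ 0 := by unfold jlRobA; exact div_ne_zero ht' h1
  have hB : jlRobB t ≠ 0 := by unfold jlRobB; positivity
  rw [jlRobertsR_eq_jlOfDelta κ t hA hB]
  refine eIU_jlOfDelta_eq_zero
    (robertsFamily_isRealNormalizedCC (jlRobA t) (jlRobB t) hA hB (jlRobA_sq_add_jlRobB_sq t))
    κ hκ0 ?_
  rw [robertsMasses_sum, hκ]
  norm_num

/-- The signed Roberts curve lies in the ENRICHED solution set S3.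
[cite: HamptonJensen2011, §2 p. 4; AlbouyKaloshin2012, p. 543 — derived in-tree] -/
theorem jlRobertsR_mem_s3 (κ t : ℝ) (hκ : κ ^ 3 = 8 / 17) (ht : 1 < t) :
    jlRobertsR κ t ∈ s3NormalizedCCs ℝ robertsMasses :=
  ⟨jlRobertsR_mem κ t hκ ht,
   cmRankLE4_of_planar _ (fun k => κ * ![jlRobA t, -jlRobA t, 0, 0, 0] k)
     (fun k => κ * ![0, 0, jlRobB t, -jlRobB t, 0] k) (jlRobertsR_sq κ t),
   eIU_jlRobertsR κ t hκ ht⟩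

/-- S3 IS NOT FINITE at the masses `(1/2,1/2,1/2,1/2,1/8)`.
[cite: JensenLeykin2025, §4.2 p. 6 — derived in-tree] -/
theorem s3NormalizedCCs_robertsMasses_infinite : (s3NormalizedCCs ℝ robertsMasses).Infinite := by
  obtain ⟨κ, hκ⟩ := exists_kappa
  have hκ0 : κ ≠ 0 := by rintro rfl; norm_num at hκ
  have hsub : jlRobertsR κ '' Set.Ioi 1 ⊆ s3NormalizedCCs ℝ robertsMasses := by
    rintro _ ⟨t, ht, rfl⟩
    exact jlRobertsR_mem_s3 κ t hκ ht
  exact ((Set.Ioi_infinite (1 : ℝ)).image (jlRobertsR_injOn κ hκ0)).mono hsub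

/-- … nor at `(4,4,4,4,1) ∈ E32`. [cite: JensenLeykin2025, §4.2 p. 6 — derived in-tree] -/
theorem s3NormalizedCCs_44441_infinite : (s3NormalizedCCs ℝ ![4, 4, 4, 4, 1]).Infinite := by
  have h : (![4, 4, 4, 4, 1] : Fin 5 → ℝ) = fun k => (8 : ℝ) * robertsMasses k := by
    funext k; fin_cases k <;> simp [robertsMasses] <;> norm_num
  rw [h, s3NormalizedCCs_smul_masses (8 : ℝ) (by norm_num)]
  exact s3NormalizedCCs_robertsMasses_infinite

/-- NO S3 CERTIFICATE INSIDE `E32` COVERS THE ROBERTS LINE: every polynomial witnessing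
`E32S3Target` vanishes at `(4s,4s,s)`, `s ≠ 0`. [cite: JensenLeykin2025, §4.2 p. 6 — derived
in-tree] -/
theorem e32S3Target_poly_vanishes_on_robertsLine (P : MvPolynomial (Fin 3) ℚ)
    (hP : ∀ (K : Type) [Field K] [CharZero K] (a b c : K),
      MvPolynomial.aeval ![a, b, c] P ≠ 0 → (s3NormalizedCCs K ![a, a, b, b, c]).Finite)
    (s : ℝ) (hs : s ≠ 0) :
    MvPolynomial.aeval (![4 * s, 4 * s, s] : Fin 3 → ℝ) P = 0 := by
  by_contra h
  have hfin := hP ℝ (4 * s) (4 * s) s h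
  have e : (![4 * s, 4 * s, 4 * s, 4 * s, s] : Fin 5 → ℝ)
      = fun k => s * (![4, 4, 4, 4, 1] : Fin 5 → ℝ) k := by
    funext k; fin_cases k <;> simp <;> ring
  rw [e, s3NormalizedCCs_smul_masses s hs] at hfin
  exact s3NormalizedCCs_44441_infinite hfin

/-- In particular at `(a,b,c) = (4,4,1)`. [cite: JensenLeykin2025, §4.2 p. 6 — derived in-tree] -/
theorem e32S3Target_poly_vanishes_at_441 (P : MvPolynomial (Fin 3) ℚ)
    (hP : ∀ (K : Type) [Field K] [CharZero K] (a b c : K),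
      MvPolynomial.aeval ![a, b, c] P ≠ 0 → (s3NormalizedCCs K ![a, a, b, b, c]).Finite) :
    MvPolynomial.aeval (![4, 4, 1] : Fin 3 → ℝ) P = 0 := by
  have h := e32S3Target_poly_vanishes_on_robertsLine P hP 1 one_ne_zero
  simpa using h

end Literature.Dynamics.NBody
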